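import Mathlib
import Summits.Ventures.HodgeRepro2.T6Interface

/-!
# T6InterfaceConj — complex conjugation on `H^*(B, ℂ) = HBC K` (coefficient conjugation)

Cell pub-hodge-repro2, Tier 6 (README §10), seat t6-lead (gen 2). The interface's complex cohomology
is `HBC K = ExteriorAlgebra ℂ (Fin 4 → ℂ ⊗[ℚ] K)`, the base change of `HB K = ExteriorAlgebra ℚ (Fin 4 → K)`.
Complex conjugation on `H^*(B, ℚ) ⊗_ℚ ℂ` through the coefficients — ID-4's `conj` of the N1 datum
(`T6N1Datum.N1Datum.conj`) in the one explicit surface model we have (`T6InterfaceToyN`, `HS = HBC K`)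
— is built here:

* `conjKC : KC K →ₐ[ℚ] KC K` — `Algebra.TensorProduct.map` of `z ↦ \bar z` on `ℂ` and the identity
  of `K`; it is `ℂ`-antilinear (`conjKC_smul`) and an involution (`conjKC_conjKC`);
* `conjH1 : H1C K → H1C K` — coordinatewise;
* `conjHBC : HBC K →+* HBC K` — the ring endomorphism of the exterior algebra extending `conjH1`
  (`ExteriorAlgebra.lift` into `HBC K` carrying the conjugate `ℂ`-algebra structure `HBCconj K`),
  with `conjHBC (z • x) = conj z • conjHBC x` (`conjHBC_smul`), `conjHBC (ι v) = ι (conjH1 v)`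
  (`conjHBC_ι`), `conjHBC (algebraMap ℂ _ z) = algebraMap ℂ _ (conj z)` (`conjHBC_algebraMap`) and
  `conjHBC (conjHBC x) = x` (`conjHBC_conjHBC`, by `ExteriorAlgebra.induction`).

Consumer: `T6NAutToyN` (the toy `NAut` whose N1 binder is joint with the automorphic ones).

§8(d): uses an L-value-free non-vanishing device: NO.
-/

namespace Summit.Ventures.HodgeRepro2.T6.Conj

open ExteriorAlgebra

variable {K : Type*} [Field K] [NumberField K]

/-- Complex conjugation as a `ℚ`-algebra automorphism of `ℂ`. -/
noncomputable def conjQ : ℂ →ₐ[ℚ] ℂ := (Complex.conjAe.restrictScalars ℚ).toAlgHom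

/-- `conjQ` is `starRingEnd ℂ` pointwise. -/
@[simp] lemma conjQ_apply (z : ℂ) : conjQ z = starRingEnd ℂ z := rfl

/-- Coefficient conjugation on `KC K = ℂ ⊗[ℚ] K`. -/
noncomputable def conjKC : KC K →ₐ[ℚ] KC K :=
  Algebra.TensorProduct.map conjQ (AlgHom.id ℚ K)

/-- `conjKC` on pure tensors: conjugate the coefficient. -/
@[simp] lemma conjKC_tmul (z : ℂ) (k : K) :
    conjKC (z ⊗ₜ[ℚ] k : KC K) = (starRingEnd ℂ z) ⊗ₜ[ℚ] k := rfl

/-- `conjKC` is `ℂ`-antilinear. -/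
lemma conjKC_smul (z : ℂ) (x : KC K) : conjKC (z • x) = (starRingEnd ℂ z) • conjKC x := by
  induction x using TensorProduct.induction_on with
  | zero => simp
  | tmul a k =>
    rw [TensorProduct.smul_tmul', conjKC_tmul, conjKC_tmul, TensorProduct.smul_tmul',
      smul_eq_mul, smul_eq_mul, map_mul]
  | add x y hx hy => rw [smul_add, map_add, hx, hy, map_add, smul_add]

/-- `conjKC` is an involution. -/
lemma conjKC_conjKC (x : KC K) : conjKC (conjKC x) = x := by
  induction x using TensorProduct.induction_on with
  | zero => simp
  | tmul a k => simp
  | add x y hx hy => rw [map_add, map_add, hx, hy]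

/-- Coordinatewise conjugation on `H1C K = Fin 4 → KC K`. -/
noncomputable def conjH1 (v : H1C K) : H1C K := fun i => conjKC (v i)

/-- `conjH1` coordinatewise. -/
@[simp] lemma conjH1_apply (v : H1C K) (i : Fin 4) : conjH1 v i = conjKC (v i) := rfl

/-- `conjH1` is additive. -/
lemma conjH1_add (v w : H1C K) : conjH1 (v + w) = conjH1 v + conjH1 w := by
  ext i; simp [conjH1]

/-- `conjH1` is `ℂ`-antilinear. -/
lemma conjH1_smul (z : ℂ) (v : H1C K) : conjH1 (z • v) = (starRingEnd ℂ z) • conjH1 v := by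
  ext i; simp [conjH1, conjKC_smul]

/-- `conjH1` is an involution. -/
lemma conjH1_conjH1 (v : H1C K) : conjH1 (conjH1 v) = v := by
  ext i; simp [conjH1, conjKC_conjKC]

/-- `HBC K` with the conjugate `ℂ`-algebra structure (`z` acts as `\bar z`). -/
def HBCconj (K : Type*) [Field K] [NumberField K] : Type _ := HBC K

/-- The ring structure of `HBCconj K` is that of `HBC K`. -/
noncomputable instance instRingHBCconj : Ring (HBCconj K) := inferInstanceAs (Ring (HBC K))

/-- The structure map of the conjugate structure: `z ↦ \bar z · 1`. -/
noncomputable def algebraMapConj : ℂ →+* HBCconj K :=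
  ((algebraMap ℂ (HBC K)).comp (starRingEnd ℂ) : ℂ →+* HBC K)

/-- The conjugate `ℂ`-algebra structure on `HBCconj K`: `z • x = \bar z • x`. -/
noncomputable instance instAlgebraHBCconj : Algebra ℂ (HBCconj K) :=
  RingHom.toAlgebra' algebraMapConj (fun c x => Algebra.commutes (A := HBC K) (starRingEnd ℂ c) x)

/-- The structure map of the conjugate structure, in `HBC K`. -/
lemma HBCconj_algebraMap (z : ℂ) :
    (algebraMap ℂ (HBCconj K) z : HBC K) = algebraMap ℂ (HBC K) (starRingEnd ℂ z) := rfl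

/-- The scalar action of the conjugate structure, in `HBC K`. -/
lemma HBCconj_smul_def (z : ℂ) (x : HBC K) :
    (z • (show HBCconj K from x) : HBCconj K) = (starRingEnd ℂ z) • x := by
  show (algebraMap ℂ (HBC K) (starRingEnd ℂ z) : HBC K) * x = _
  rw [Algebra.smul_def]

/-- The antilinear generator map `v ↦ ι (conjH1 v)`, `ℂ`-linear into the conjugate structure. -/
noncomputable def genConj : H1C K →ₗ[ℂ] HBCconj K where
  toFun v := (ι ℂ (conjH1 v) : HBC K)
  map_add' v w := by
    show (ι ℂ (conjH1 (v + w)) : HBC K) = ι ℂ (conjH1 v) + ι ℂ (conjH1 w)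
    rw [conjH1_add, map_add]
  map_smul' z v := by
    simp only [RingHom.id_apply]
    show (ι ℂ (conjH1 (z • v)) : HBC K) = z • (show HBCconj K from ι ℂ (conjH1 v))
    rw [HBCconj_smul_def, conjH1_smul, map_smul]

/-- `genConj` on a vector. -/
lemma genConj_apply (v : H1C K) : (genConj v : HBC K) = ι ℂ (conjH1 v) := rfl

/-- The generator map squares to zero (it lands in the image of `ι`). -/
lemma genConj_sq_zero (v : H1C K) : genConj v * genConj v = 0 := by
  show (ι ℂ (conjH1 v) : HBC K) * ι ℂ (conjH1 v) = 0
  exact ι_sq_zero _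

/-- The conjugation as a `ℂ`-algebra map into the conjugate structure. -/
noncomputable def conjAlg : HBC K →ₐ[ℂ] HBCconj K :=
  ExteriorAlgebra.lift ℂ ⟨genConj, genConj_sq_zero⟩

/-- COMPLEX CONJUGATION ON `H^*(B, ℂ)`: the ring endomorphism of `HBC K` extending the coefficient
conjugation of `ℂ ⊗[ℚ] K`. -/
noncomputable def conjHBC : HBC K →+* HBC K := ((conjAlg (K := K)).toRingHom : HBC K →+* HBCconj K)

/-- `conjHBC` is `conjAlg` read in `HBC K`. -/
lemma conjHBC_apply (x : HBC K) : conjHBC x = (conjAlg x : HBC K) := rfl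

/-- `conjHBC` on generators: `conjH1`. -/
@[simp] lemma conjHBC_ι (v : H1C K) : conjHBC (ι ℂ v) = ι ℂ (conjH1 v) := by
  rw [conjHBC_apply]
  show (ExteriorAlgebra.lift ℂ ⟨genConj, genConj_sq_zero⟩ (ι ℂ v) : HBC K) = _
  rw [ExteriorAlgebra.lift_ι_apply]
  rfl

/-- `conjHBC` on scalars: complex conjugation. -/
@[simp] lemma conjHBC_algebraMap (z : ℂ) :
    conjHBC (algebraMap ℂ (HBC K) z) = algebraMap ℂ (HBC K) (starRingEnd ℂ z) := by
  rw [conjHBC_apply]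
  have h := (conjAlg (K := K)).commutes z
  show (conjAlg (algebraMap ℂ (HBC K) z) : HBC K) = _
  rw [h]
  rfl

/-- `conjHBC` is `ℂ`-antilinear. -/
lemma conjHBC_smul (z : ℂ) (x : HBC K) : conjHBC (z • x) = (starRingEnd ℂ z) • conjHBC x := by
  rw [conjHBC_apply, conjHBC_apply]
  have h := map_smul (conjAlg (K := K)) z x
  show (conjAlg (z • x) : HBC K) = _
  rw [h]
  exact HBCconj_smul_def z (conjAlg x)

/-- `conjHBC` is an involution. -/
lemma conjHBC_conjHBC (x : HBC K) : conjHBC (conjHBC x) = x := by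
  induction x using ExteriorAlgebra.induction with
  | algebraMap r => rw [conjHBC_algebraMap, conjHBC_algebraMap, Complex.conj_conj]
  | ι v => rw [conjHBC_ι, conjHBC_ι, conjH1_conjH1]
  | mul a b ha hb => rw [map_mul, map_mul, ha, hb]
  | add a b ha hb => rw [map_add, map_add, ha, hb]

end Summit.Ventures.HodgeRepro2.T6.Conj
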